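import Literature.MathematicalPhysics.QuantumManyBody.JelliumSliceProjections
import HarnessLib

/-!
# Algebra of the condensate projections `Pᵢ`, `Qⱼ`: measurability, bounds, commutation

Topic `Literature/MathematicalPhysics/QuantumManyBody` (the charged Bose gas, `JelliumBoseGas.foldyLaw`).
Step (2a) of the first-quantized route to [LiebSolovej2001, Thm. 9.2] (see
`JelliumSliceProjections.lean`): the operators `Pⱼ` (average over the `j`-th variable in the box)
and `Qⱼ = 1 - Pⱼ`, `n̂₀ = ∑ⱼPⱼ`, `n̂₊ = ∑ⱼQⱼ` [LiebSolovej2001, §5], acting on continuous `n`-body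
functions:

* `measurable_sliceMean`, `measurable_sliceFluct`;
* `norm_sliceMean_le` — `|PⱼΨ(X)| ≤ sup_{fibre}|Ψ|`;
* `sliceMean_eq_self` — `PⱼF = F` if `F` does not depend on `xⱼ`; `sliceMean_sub` (linearity);
* `integrableOn_cell_sliceMean_update` — the fibres of `PⱼΨ` are integrable;
* `sliceMean_comm` — **`PᵢPⱼ = PⱼPᵢ`** (Fubini), `sliceMean_sliceFluct_comm` — **`PᵢQⱼ = QⱼPᵢ`**,
  i.e. `[n̂₀, ·]`-bookkeeping of [LiebSolovej2001, §5] ("`n̂₀` commutes with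
  `∑_{p,q≠0} ŵ_{p0,q0}a*_pa_q`").

## References

* [LiebSolovej2001] E. H. Lieb, J. P. Solovej, Commun. Math. Phys. 217 (2001) 127–163, §5
  (arXiv:cond-mat/0007425, p. 11).
-/

noncomputable section

open MeasureTheory Set Filter Real
open scoped ENNReal NNReal Topology

namespace Literature.MathematicalPhysics.QuantumManyBody.JelliumBoseGas

open BoseGas

variable {n : ℕ} {ℓ : ℝ}

/-! ### Finite measure and compactness bookkeeping -/

/-- The restriction of Lebesgue measure to the cell is finite. [folklore] -/
theorem isFiniteMeasure_restrict_cell (ℓ : ℝ) : IsFiniteMeasure (volume.restrict (cell ℓ)) :=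
  isFiniteMeasure_restrict.2 (by rw [volume_cell]; exact ENNReal.pow_ne_top ENNReal.ofReal_ne_top)

/-- `volume.real (cell ℓ) = ℓ³` (`ℓ ≥ 0`). [folklore] -/
theorem volume_real_cell (hℓ : 0 ≤ ℓ) : volume.real (cell ℓ) = ℓ ^ 3 := by
  rw [measureReal_def, volume_cell, ENNReal.toReal_pow, ENNReal.toReal_ofReal hℓ]

/-- A continuous function is bounded on the fibres `y ↦ Ψ(X; xⱼ ↦ y)`, `y ∈ cell`, uniformly over a
second fibre variable: `‖Ψ(update (update X i y) j z)‖ ≤ C` for `y, z` in the closed box. [folklore] -/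
theorem exists_bound_update_update {Ψ : Config n → ℂ} (hΨ : Continuous Ψ) (X : Config n)
    (i j : Fin n) (ℓ : ℝ) :
    ∃ C : ℝ, ∀ y ∈ cell ℓ, ∀ z ∈ cell ℓ, ‖Ψ (Function.update (Function.update X i y) j z)‖ ≤ C := by
  have hK : IsCompact ((WithLp.toLp 2 '' Set.univ.pi fun _ : Fin 3 => Set.Icc (0 : ℝ) ℓ : Set Space) ×ˢ
      (WithLp.toLp 2 '' Set.univ.pi fun _ : Fin 3 => Set.Icc (0 : ℝ) ℓ : Set Space)) :=
    (isCompact_closedBox ℓ).prod (isCompact_closedBox ℓ)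
  have hc : Continuous fun p : Space × Space => Ψ (Function.update (Function.update X i p.1) j p.2) :=
    hΨ.comp (((continuous_const : Continuous fun _ : Space × Space => X).update i
      continuous_fst).update j continuous_snd)
  obtain ⟨C, hC⟩ := hK.exists_bound_of_continuousOn hc.continuousOn
  exact ⟨C, fun y hy z hz => hC (y, z) ⟨cell_subset_closedBox ℓ hy, cell_subset_closedBox ℓ hz⟩⟩

/-! ### Measurability -/

/-- `PⱼΨ` is measurable for continuous `Ψ`. [folklore] -/
theorem measurable_sliceMean (ℓ : ℝ) (j : Fin n) {Ψ : Config n → ℂ} (hΨ : Continuous Ψ) :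
    Measurable (sliceMean ℓ j Ψ) := by
  have h : StronglyMeasurable (Function.uncurry fun (X : Config n) (y : Space) =>
      Ψ (Function.update X j y)) :=
    (hΨ.comp (continuous_fst.update j continuous_snd)).stronglyMeasurable
  have hI : Measurable fun X : Config n => ∫ y in cell ℓ, Ψ (Function.update X j y) :=
    (h.integral_prod_right' (ν := volume.restrict (cell ℓ))).measurable
  have e : sliceMean ℓ j Ψ = fun X => (volume.real (cell ℓ))⁻¹ • ∫ y in cell ℓ, Ψ (Function.update X j y) := by
    funext X; rw [sliceMean, setAverage_eq]
  rw [e]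
  exact hI.const_smul ((volume.real (cell ℓ))⁻¹ : ℝ)

/-- `QⱼΨ` is measurable for continuous `Ψ`. [folklore] -/
theorem measurable_sliceFluct (ℓ : ℝ) (j : Fin n) {Ψ : Config n → ℂ} (hΨ : Continuous Ψ) :
    Measurable (sliceFluct ℓ j Ψ) :=
  hΨ.measurable.sub (measurable_sliceMean ℓ j hΨ)

/-! ### Bounds and linearity -/

/-- **`|PⱼΨ(X)| ≤ C`** if `|Ψ| ≤ C` on the fibre through `X` (`ℓ > 0`). [folklore] -/
theorem norm_sliceMean_le (hℓ : 0 < ℓ) (j : Fin n) {Ψ : Config n → ℂ} {X : Config n} {C : ℝ}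
    (hC : ∀ y ∈ cell ℓ, ‖Ψ (Function.update X j y)‖ ≤ C) : ‖sliceMean ℓ j Ψ X‖ ≤ C := by
  have hV : volume (cell ℓ) < ⊤ := by rw [volume_cell]; exact ENNReal.pow_lt_top ENNReal.ofReal_lt_top
  have h := norm_setIntegral_le_of_norm_le_const hV hC
  rw [sliceMean, setAverage_eq, norm_smul, norm_inv, Real.norm_eq_abs,
    abs_of_nonneg measureReal_nonneg, volume_real_cell hℓ.le] at *
  have hℓ3 : 0 < ℓ ^ 3 := by positivity
  calc (ℓ ^ 3)⁻¹ * ‖∫ y in cell ℓ, Ψ (Function.update X j y)‖ ≤ (ℓ ^ 3)⁻¹ * (C * ℓ ^ 3) :=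
        mul_le_mul_of_nonneg_left h (inv_nonneg.2 hℓ3.le)
    _ = C := by field_simp

/-- **`PⱼF = F` for `F` independent of `xⱼ`** (`ℓ > 0`). [folklore] -/
theorem sliceMean_eq_self (hℓ : 0 < ℓ) (j : Fin n) {F : Config n → ℂ} {X : Config n}
    (hF : ∀ y, F (Function.update X j y) = F X) : sliceMean ℓ j F X = F X := by
  unfold sliceMean
  simp_rw [hF]
  haveI := isFiniteMeasure_restrict_cell ℓ
  have h0 : volume (cell ℓ) ≠ 0 := by rw [volume_cell]; exact pow_ne_zero _ (by simpa using hℓ)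
  rw [setAverage_const h0 (by rw [volume_cell]; exact ENNReal.pow_ne_top ENNReal.ofReal_ne_top)]

/-- Linearity: `Pⱼ(Ψ - Φ) = PⱼΨ - PⱼΦ` on integrable fibres. [folklore] -/
theorem sliceMean_sub (ℓ : ℝ) (j : Fin n) {Ψ Φ : Config n → ℂ} {X : Config n}
    (hΨ : IntegrableOn (fun y => Ψ (Function.update X j y)) (cell ℓ))
    (hΦ : IntegrableOn (fun y => Φ (Function.update X j y)) (cell ℓ)) :
    sliceMean ℓ j (Ψ - Φ) X = sliceMean ℓ j Ψ X - sliceMean ℓ j Φ X := by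
  simp only [sliceMean, Pi.sub_apply, setAverage_eq]
  rw [integral_sub hΨ hΦ, smul_sub]

/-- The fibres of a continuous function are integrable on the cell. [folklore] -/
theorem integrableOn_cell_update {Ψ : Config n → ℂ} (hΨ : Continuous Ψ) (X : Config n) (j : Fin n)
    (ℓ : ℝ) : IntegrableOn (fun y => Ψ (Function.update X j y)) (cell ℓ) :=
  integrableOn_cell (hΨ.comp (continuous_const.update j continuous_id))

/-- **The fibres of `PⱼΨ` are integrable**: `y ↦ (PⱼΨ)(X; xᵢ ↦ y)` is integrable on the cell for
continuous `Ψ` (bounded and measurable). [folklore] -/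
theorem integrableOn_cell_sliceMean_update (hℓ : 0 < ℓ) {Ψ : Config n → ℂ} (hΨ : Continuous Ψ)
    (X : Config n) (i j : Fin n) :
    IntegrableOn (fun y => sliceMean ℓ j Ψ (Function.update X i y)) (cell ℓ) := by
  obtain ⟨C, hC⟩ := exists_bound_update_update hΨ X i j ℓ
  haveI := isFiniteMeasure_restrict_cell ℓ
  have hm : AEStronglyMeasurable (fun y => sliceMean ℓ j Ψ (Function.update X i y))
      (volume.restrict (cell ℓ)) :=
    ((measurable_sliceMean ℓ j hΨ).comp (measurable_update _)).aestronglyMeasurable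
  refine Integrable.mono' (integrable_const C) hm ?_
  refine (ae_restrict_iff' (measurableSet_cell ℓ)).2 (Eventually.of_forall fun y hy => ?_)
  exact norm_sliceMean_le hℓ j fun z hz => hC y hy z hz

/-! ### Commutation -/

/-- **`PᵢPⱼ = PⱼPᵢ`** on continuous functions (Fubini on `cell × cell`).
[cite: LiebSolovej2001, §5] -/
theorem sliceMean_comm (ℓ : ℝ) (i j : Fin n) {Ψ : Config n → ℂ} (hΨ : Continuous Ψ)
    (X : Config n) :
    sliceMean ℓ i (sliceMean ℓ j Ψ) X = sliceMean ℓ j (sliceMean ℓ i Ψ) X := by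
  rcases eq_or_ne i j with rfl | hij
  · rfl
  haveI := isFiniteMeasure_restrict_cell ℓ
  -- unfold both sides to iterated integrals
  simp only [sliceMean, setAverage_eq]
  rw [integral_smul, integral_smul, smul_comm]
  congr 2
  -- `∫_y ∫_z Ψ(update (update X i y) j z) = ∫_z ∫_y Ψ(update (update X j z) i y)`
  have hcomm : ∀ y z : Space, Function.update (Function.update X i y) j z =
      Function.update (Function.update X j z) i y := fun y z => Function.update_comm hij _ _ _
  simp_rw [hcomm]
  -- Fubini for the bounded continuous integrand on the finite product measure
  obtain ⟨C, hC⟩ := exists_bound_update_update hΨ X j i ℓ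
  have hc : Continuous fun p : Space × Space => Ψ (Function.update (Function.update X j p.1) i p.2) :=
    hΨ.comp (((continuous_const : Continuous fun _ : Space × Space => X).update j
      continuous_fst).update i continuous_snd)
  have hint : Integrable (fun p : Space × Space => Ψ (Function.update (Function.update X j p.1) i p.2))
      ((volume.restrict (cell ℓ)).prod (volume.restrict (cell ℓ))) := by
    refine Integrable.mono' (integrable_const C) hc.aestronglyMeasurable ?_
    have h1 : ∀ᵐ p ∂((volume.restrict (cell ℓ)).prod (volume.restrict (cell ℓ))),
        p ∈ cell ℓ ×ˢ cell ℓ := by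
      rw [Measure.prod_restrict]
      exact ae_restrict_mem ((measurableSet_cell ℓ).prod (measurableSet_cell ℓ))
    filter_upwards [h1] with p hp
    exact hC p.1 hp.1 p.2 hp.2
  exact (integral_integral_swap hint).symm

/-- **`PᵢQⱼ = QⱼPᵢ`** on continuous functions (`ℓ > 0`; for `i = j` both sides vanish).
[cite: LiebSolovej2001, §5] -/
theorem sliceMean_sliceFluct_comm (hℓ : 0 < ℓ) (i j : Fin n) {Ψ : Config n → ℂ}
    (hΨ : Continuous Ψ) (X : Config n) :
    sliceMean ℓ i (sliceFluct ℓ j Ψ) X = sliceFluct ℓ j (sliceMean ℓ i Ψ) X := by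
  have e1 : sliceFluct ℓ j Ψ = Ψ - sliceMean ℓ j Ψ := by funext Y; rfl
  rw [e1, sliceMean_sub ℓ i (integrableOn_cell_update hΨ X i ℓ)
    (integrableOn_cell_sliceMean_update hℓ hΨ X i j), sliceFluct, sliceMean_comm ℓ i j hΨ X]

end Literature.MathematicalPhysics.QuantumManyBody.JelliumBoseGas
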